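import Literature.ModelTheory.ExponentialFields.RealAnExp
import Literature.RingTheory.MvPowerSeries.OfAnalytic
import HarnessLib

/-!
# Restricted analytic functions are piecewise convergent power series

Topic `Literature/ModelTheory/ExponentialFields`.  A restricted analytic function of arity `n`
(`RestrictedAnalytic n`, `RealAnExp.lean`: real analytic, in Mathlib's sense `AnalyticOnNhd ℝ`, on
an open neighbourhood of the closed unit cube `[0, 1]ⁿ`; Pila 2022, 8.21) is covered as follows:
there are finitely many centres `a` with radii `ρₐ > 0` and power series `Pₐ ∈ ℝ⟦X₁, …, Xₙ⟧`,
`‖Pₐ‖_{ρₐ} < ∞` (weighted `ℓ¹`-norm of `Literature/RingTheory/MvPowerSeries/ConvergentPowerSeries.lean`),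
such that `f(v) = Pₐ(v - a)` on the closed box `|vᵢ - aᵢ| ≤ ρₐ` and the three times smaller
boxes `|vᵢ - aᵢ| ≤ ρₐ / 3` already cover the cube (`RestrictedAnalytic.exists_finset_cover_series`,
from `Literature.RingTheory.MvPowerSeries.exists_finset_cover_eval_eq_of_analyticOnNhd_shrink`).
Since `2 (ρₐ/3) < ρₐ`, each piece `v ↦ Pₐ(v - a)` on its small box is exactly the datum turned
into a term of the Denef–van den Dries language of `ℝ_an` by `Term.ofGerm` / `eval_ofGerm`
(`RealAnTerms.lean`: "a power series `f` with `‖f‖_ρ < ∞` defines, on every box `|v - a| ≤ δ`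
with `2δ < ρ`, the term `v ↦ f(v - a)`").  This is the first step in interpreting the symbols
`an f` of `Language.realAnExp` (`RealAnExp.lean`) inside `ℝ_an`; nothing here is a named fact.

## References

* [Pila2022] J. Pila, *Point-counting and the Zilber–Pink conjecture* (2022), 8.21.
* [DenefvandenDries1988] J. Denef, L. van den Dries, Ann. of Math. 128 (1988), §4.
* [GrauertRemmert1971] H. Grauert, R. Remmert, *Analytische Stellenalgebren* (1971), Kap. I §3.
-/

noncomputable section

open Set
open scoped NNReal ENNReal

namespace Literature.ModelTheory.ExponentialFields

open Literature.RingTheory.MvPowerSeries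

namespace RestrictedAnalytic

variable {n : ℕ}

/-- **A restricted analytic function is piecewise a convergent power series**: for
`f : RestrictedAnalytic n` there are finitely many centres `a ∈ [0,1]ⁿ`, radii `ρₐ > 0` and power
series `Pₐ` with `‖Pₐ‖_{ρₐ} < ∞` and `f(v) = Pₐ(v - a)` whenever `|vᵢ - aᵢ| ≤ ρₐ` for all `i`,
such that the boxes `|vᵢ - aᵢ| ≤ ρₐ / 3` cover the closed unit cube. [folklore] -/
theorem exists_finset_cover_series (f : RestrictedAnalytic n) :
    ∃ (s : Finset (Fin n → ℝ)) (ρ : (Fin n → ℝ) → ℝ≥0) (P : (Fin n → ℝ) → MvPowerSeries (Fin n) ℝ),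
      (↑s ⊆ Set.Icc (0 : Fin n → ℝ) 1) ∧
      (∀ a ∈ s, 0 < ρ a ∧ wnorm (fun _ : Fin n => ρ a) (P a) < ⊤ ∧
        ∀ v : Fin n → ℝ, (∀ i, ‖v i - a i‖₊ ≤ ρ a) → eval (P a) (v - a) = f.toFun v) ∧
      Set.Icc (0 : Fin n → ℝ) 1 ⊆ ⋃ a ∈ s, {v : Fin n → ℝ | ∀ i, ‖v i - a i‖₊ ≤ ρ a / 3} := by
  obtain ⟨U, -, hcube, hf⟩ := f.exists_analyticOnNhd
  obtain ⟨s, ρ, P, hsK, hs, hcover⟩ :=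
    exists_finset_cover_eval_eq_of_analyticOnNhd_shrink hf isCompact_Icc hcube
      (c := 1 / 3) (by norm_num)
  refine ⟨s, ρ, P, hsK, hs, hcover.trans (Set.iUnion₂_mono fun a _ v hv i => ?_)⟩
  have h := (hv i).le
  rwa [one_div, ← div_eq_inv_mul] at h

/-- On the pieces, `2 · (ρₐ / 3) < ρₐ`: the small boxes are boxes `|v - a| ≤ δ` with `2δ < ρ` in
the sense of `RealAnTerms.lean` (`Term.ofGerm`). [folklore] -/
theorem two_mul_div_three_lt {ρ : ℝ≥0} (hρ : 0 < ρ) : 2 * (ρ / 3) < ρ := by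
  rw [mul_div_assoc', div_lt_iff₀ (by norm_num : (0 : ℝ≥0) < 3)]
  have h : (2 : ℝ≥0) * ρ < 3 * ρ := mul_lt_mul_of_pos_right (by norm_num) hρ
  simpa [mul_comm] using h

end RestrictedAnalytic

end Literature.ModelTheory.ExponentialFields

end
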